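/-
Origin: expansion seat `prover-pub-hodgecm-mc-carch-1-g3-0`, handover #CA26 2026-08-20T07:05Z md5 40fd297fd8fd (183 l., 10 decls; NEW additive leaf; imports installed #CA18 Model.ArchKTypeOfFin (RUN 42) only; RUN 43; drop-alone; cert certs/ax-ArchKTypeOfFinChar-40fd297fd8fd.log: rc 0 / 29 s / 0 warnings / 10/10 trio) (`HOME/mc/pub-hodgecm-mc-carch-1/pkg43/HodgeCM/Model/ArchKTypeOfFinChar.lean`, md5 40fd297fd8fd, 183 lines);
landed by the gen-16 packager (p-g16) in gate run 43 as `HodgeCM/Model/ArchKTypeOfFinChar.lean` (verbatim).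
-/
/-
Copyright (c) 2026. Released under Apache 2.0 license as described in the file LICENSE.
Cell pub-hodgecm, MODEL layer (construction prover mc-carch-1, gen 3), (C-LINE1) RULING SUPPLEMENT 4 (R1): GENERIC RE-CUT of #CA18
`Model/ArchKTypeOfFin` § 3 — (D-2) `hfin` for lines 0 and 1 of the character-generic S term (`lineRepOf … η₀ η₁ η₂ η₃ k`), from the
continuity of `η₀` resp. `η₁` alone (+ the plane sign at `ι₁` for line 0).  Every decl `X` of #CA18 § 3 reappears as `XG` with
`lineRepD … η ↦ lineRepOf … η₀ η₁ η₂ η₃`, `etaₖ V S η ↦ ηₖ`, `continuous_cmEtaₖ… hηc ↦ hηₖc`; §§ 1, 2 (frame transport, `deepLevel`) are imported.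
At period-1's R1 split `(etaT₀ η ν, etaT₁ η ν, eta₂ η, eta₃ η)` the continuity inputs are their `continuous_etaT₀/₁`.
Nothing is cited here and nothing is minted: 0 records, 0 `def … : Prop`.
-/
import Summits.HodgeConjecture.HodgeCM.Model.ArchKTypeOfFin_2

/-!
# (D-2) `hfin` over four line characters

* `lineRepOf_zero/one_regime_finAdelicG` — `lineRepOf … k ((1,k_f)^reg, 1) = cmLineRepFinₖ ηₖ ((1, finFrameCongr k_f), 1)` (`rfl` after #CA18's frame lemma);
* `exists_deepFix_zeroG (hη₀c) (h₁W)` / `exists_deepFix_oneG (hη₁c)` — K-1's deep-level fixed vectors for `cmLineRepFin₀ η₀` / `cmLineRepFin₁ η₁`;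
* `deepIndexZeroG/OneG`, `hfin_zero_deepLevelG` / `hfin_one_deepLevelG` — LITERALLY the `hfinₖ` inputs of #CA25 `archKTypeOfSideG` at
  `Γ₀ := deepLevel V M hM`, `deepIndexₖG ∣ M`.
-/



set_option autoImplicit false

noncomputable section

open Filter Topology Complex
open NumberField NumberField.InfinitePlace NumberField.mixedEmbedding IsDedekindDomain MeasureTheory
open scoped Matrix TensorProduct Classical SchwartzMap
open MulAction
open Literature.Geometry.ComplexHyperbolic.BallModel (U21 x₀ stabilizerEquivK21)
open Literature.AlgebraicGeometry.HodgeTheory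
open Literature.AlgebraicGeometry.ShimuraVarieties
open Literature.NumberTheory.Automorphic Literature.NumberTheory.Weil1964
open Literature.NumberTheory.GelbartRogawski1991 Literature.NumberTheory.GelbartRogawski1991.UnitaryDualPair
open Literature.NumberTheory.Automorphic.PicardCM
open HodgeCM.Adelic HodgeCM.PerL34 HodgeCM.Model.HypCensus HodgeCM.Model.SupplyInstance HodgeCM.Model.ArchSideTerm

namespace HodgeCM.Model
section FinChar

variable {L : CMField} {ι₁ : L →+* ℂ} (V : HermSpace3 L ι₁) (S : StubTree.SeesawDatum L)
variable
  (hGR : (cmSplittingDatum (L : Type) finProdFinEquiv (frameD V) (frameD_real V) (frameD_ne V) (dW S) (dW_real S) (dW_ne S)).CompatibleSplitting)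
  (hGR₀ : (cmSplittingDatum (L : Type) (e₁) (frameD V) (frameD_real V) (frameD_ne V) (lineVec (L : Type) (dW S 0))
    (fun _ => dW_real S 0) (fun _ => dW_ne S 0)).CompatibleSplitting)
  (hGR₁ : (cmSplittingDatum (L : Type) (e₁) (frameD V) (frameD_real V) (frameD_ne V) (lineVec (L : Type) (dW S 1))
    (fun _ => dW_real S 1) (fun _ => dW_ne S 1)).CompatibleSplitting)
  (hGR₂ : (cmSplittingDatum (L : Type) (e₁) (frameD V) (frameD_real V) (frameD_ne V) (lineVec (L : Type) (dW' S 0))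
    (fun _ => dW'_real S 0) (fun _ => dW'_ne S 0)).CompatibleSplitting)
  (hGR₃ : (cmSplittingDatum (L : Type) (e₁) (frameD V) (frameD_real V) (frameD_ne V) (lineVec (L : Type) (dW' S 1))
    (fun _ => dW'_real S 1) (fun _ => dW'_ne S 1)).CompatibleSplitting)
  (η₀ η₁ η₂ η₃ : CMAdelic (L : Type) (frameD V) × CMAdelicOne (L : Type) →* ℂˣ)
  (hV : IsAnisotropic L V.Hm)

/-- **line 0**: `lineRepD 0 (regimeEquiv hV (1, k_f), 1) = cmLineRepFin₀ η₀ ((1, finFrameCongr k_f), 1)`. -/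
theorem lineRepOf_zero_regime_finAdelicG
    (kf : UnitaryGroup.finAdelic (↥(maximalRealSubfield L)) L (IsCMField.complexConj L) 3 V.Hm) :
    lineRepOf V S hGR hGR₀ hGR₁ hGR₂ hGR₃ η₀ η₁ η₂ η₃ 0
        (HodgeCM.Adelic.regimeEquiv L V.Hm hV
          (UnitaryGroup.finAdelicToAdelic (↥(maximalRealSubfield L)) L (IsCMField.complexConj L) 3 V.Hm kf), 1) =
      cmLineRepFin₀ (L : Type) finProdFinEquiv e₁ (frameD V) (frameD_real V) (frameD_ne V) (dW S) (dW_real S) (dW_ne S)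
        hGR hGR₀ hGR₁ η₀
        (UnitaryGroup.finAdelicToAdelic (↥(maximalRealSubfield L)) L (IsCMField.complexConj L) 3 (Matrix.diagonal (frameD V))
          (finFrameCongr (L : Type) V.Hm (frameG V) (frameD V) (frame_congr V) kf), 1) := by
  rw [← cmFrameEquiv_regime_finAdelicToAdelic V hV kf]
  rfl

/-- **line 1**: `lineRepD 1 (regimeEquiv hV (1, k_f), 1) = cmLineRepFin₁ η₁ ((1, finFrameCongr k_f), 1)`. -/
theorem lineRepOf_one_regime_finAdelicG
    (kf : UnitaryGroup.finAdelic (↥(maximalRealSubfield L)) L (IsCMField.complexConj L) 3 V.Hm) :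
    lineRepOf V S hGR hGR₀ hGR₁ hGR₂ hGR₃ η₀ η₁ η₂ η₃ 1
        (HodgeCM.Adelic.regimeEquiv L V.Hm hV
          (UnitaryGroup.finAdelicToAdelic (↥(maximalRealSubfield L)) L (IsCMField.complexConj L) 3 V.Hm kf), 1) =
      cmLineRepFin₁ (L : Type) finProdFinEquiv e₁ (frameD V) (frameD_real V) (frameD_ne V) (dW S) (dW_real S) (dW_ne S)
        hGR hGR₀ hGR₁ η₁
        (UnitaryGroup.finAdelicToAdelic (↥(maximalRealSubfield L)) L (IsCMField.complexConj L) 3 (Matrix.diagonal (frameD V))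
          (finFrameCongr (L : Type) V.Hm (frameG V) (frameD V) (frame_congr V) kf), 1) := by
  rw [← cmFrameEquiv_regime_finAdelicToAdelic V hV kf]
  rfl

/-- **(D-2) FOR LINE 0 in `U(diag frameD V)(𝔸_f)` currency** (the K-1 twin of the tree theorem at the pin's data; `hV`-free): under the
plane sign `h₁W` at `ι₁` (Weil's majorants, vendored `…CMLinesMajorants` `_of_signs`) and continuity of `η`, for every base point `x` and test
level `N` there is `n₀ ≠ 0` such that every `k ∈ K_{U(diag frameD V),f}(M)`, `n₀ ∣ M ≠ 0`, fixes every `φ_N(Φ_∞)` under `cmLineRepFin₀ η₀`.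
[tree: GelbartRogawski1991 §3.1 Remark p. 457; Weil1964 n° 41 Thm 6] -/
theorem exists_deepFix_zeroG (hη₀c : Continuous fun p => ((η₀ p : ℂˣ) : ℂ))
    (h₁W : (∀ j, 0 < (ι₁ (dW S j)).re) ∨ ∀ j, (ι₁ (dW S j)).re < 0)
    (x : Fin 3 → ↥(maximalRealSubfield L)) (N : ℕ) :
    ∃ n₀ : ℕ, n₀ ≠ 0 ∧ ∀ M : ℕ, M ≠ 0 → n₀ ∣ M →
      ∀ k ∈ UnitaryGroup.finCongruenceLevel (↥(maximalRealSubfield L)) (L : Type) (IsCMField.complexConj L) 3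
          (Matrix.diagonal (frameD V)) (Ideal.span {(M : 𝓞 L)}),
        ∀ Φinf : 𝓢((Fin 3 → mixedSpace (↥(maximalRealSubfield L))), ℂ),
          cmLineRepFin₀ (L : Type) finProdFinEquiv e₁ (frameD V) (frameD_real V) (frameD_ne V) (dW S) (dW_real S) (dW_ne S)
              hGR hGR₀ hGR₁ η₀
              (UnitaryGroup.finAdelicToAdelic (↥(maximalRealSubfield L)) L (IsCMField.complexConj L) 3 (Matrix.diagonal (frameD V)) k, 1)
              (testFun (↥(maximalRealSubfield L)) (Fin 3) Φinf x N) =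
            testFun (↥(maximalRealSubfield L)) (Fin 3) Φinf x N := by
  obtain ⟨n₀, hn₀, hfix⟩ :=
    exists_nat_forall_dvd_finCongruenceLevel_forall_cmLineRepFin₀_thinCosetTestFunₗ_eq_self (L : Type) finProdFinEquiv e₁
      (frameD V) (frameD_real V) (frameD_ne V) (dW S) (dW_real S) (dW_ne S) hGR hGR₀ hGR₁ η₀
      (hasThetaMajorants_cmPairSplitting_of_signs_two (L : Type) finProdFinEquiv (frameD V) (frameD_real V) (frameD_ne V) (dW S)
        (dW_real S) (dW_ne S) ι₁ hGR (frameD_sign_ι₁' V) h₁W (frameD_sign_of_ne V))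
      (hasThetaMajorants_omega_pairSmall₁_lineVec_of_signs (L : Type) e₁ (frameD V) (frameD_real V) (frameD_ne V) (dW S 0)
        (dW_real S 0) (dW_ne S 0) hGR₀ ι₁ (frameD_sign_ι₁' V) (frameD_sign_of_ne V))
      (hasThetaMajorants_omega_pairSmall₂_lineVec_of_signs (L : Type) e₁ (frameD V) (frameD_real V) (frameD_ne V) (dW S 1)
        (dW_real S 1) (dW_ne S 1) hGR₁ ι₁ (frameD_sign_ι₁' V) (frameD_sign_of_ne V))
      hη₀c (A := Unit)
      (fun _ => finEmb (↥(maximalRealSubfield L)) (Fin 3) x) (fun _ => Ideal.span {(N : 𝓞 ↥(maximalRealSubfield L))})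
  exact ⟨n₀, hn₀, fun M hM hdvd k hk Φinf => hfix M hM hdvd k hk () Φinf⟩

/-- **(D-2) FOR LINE 1 in `U(diag frameD V)(𝔸_f)` currency** (no sign hypothesis: the second line's small character is trivial on `U(V)`). -/
theorem exists_deepFix_oneG (hη₁c : Continuous fun p => ((η₁ p : ℂˣ) : ℂ))
    (x : Fin 3 → ↥(maximalRealSubfield L)) (N : ℕ) :
    ∃ n₀ : ℕ, n₀ ≠ 0 ∧ ∀ M : ℕ, M ≠ 0 → n₀ ∣ M →
      ∀ k ∈ UnitaryGroup.finCongruenceLevel (↥(maximalRealSubfield L)) (L : Type) (IsCMField.complexConj L) 3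
          (Matrix.diagonal (frameD V)) (Ideal.span {(M : 𝓞 L)}),
        ∀ Φinf : 𝓢((Fin 3 → mixedSpace (↥(maximalRealSubfield L))), ℂ),
          cmLineRepFin₁ (L : Type) finProdFinEquiv e₁ (frameD V) (frameD_real V) (frameD_ne V) (dW S) (dW_real S) (dW_ne S)
              hGR hGR₀ hGR₁ η₁
              (UnitaryGroup.finAdelicToAdelic (↥(maximalRealSubfield L)) L (IsCMField.complexConj L) 3 (Matrix.diagonal (frameD V)) k, 1)
              (testFun (↥(maximalRealSubfield L)) (Fin 3) Φinf x N) =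
            testFun (↥(maximalRealSubfield L)) (Fin 3) Φinf x N := by
  obtain ⟨n₀, hn₀, hfix⟩ :=
    exists_nat_forall_dvd_finCongruenceLevel_forall_cmLineRepFin₁_thinCosetTestFunₗ_eq_self (L : Type) finProdFinEquiv e₁
      (frameD V) (frameD_real V) (frameD_ne V) (dW S) (dW_real S) (dW_ne S) hGR hGR₀ hGR₁ η₁
      hη₁c (A := Unit)
      (fun _ => finEmb (↥(maximalRealSubfield L)) (Fin 3) x) (fun _ => Ideal.span {(N : 𝓞 ↥(maximalRealSubfield L))})
  exact ⟨n₀, hn₀, fun M hM hdvd k hk Φinf => hfix M hM hdvd k hk () Φinf⟩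

/-- **the (D-2) index of line 0** (`n₀` of `exists_deepFix_zeroG`, chosen). -/
def deepIndexZeroG (hη₀c : Continuous fun p => ((η₀ p : ℂˣ) : ℂ))
    (h₁W : (∀ j, 0 < (ι₁ (dW S j)).re) ∨ ∀ j, (ι₁ (dW S j)).re < 0) (x : Fin 3 → ↥(maximalRealSubfield L)) (N : ℕ) : ℕ :=
  Classical.choose (exists_deepFix_zeroG V S hGR hGR₀ hGR₁ η₀ hη₀c h₁W x N)

/-- (Ported verbatim from the HodgeCMPerL package; no docstring in the source.) -/
theorem deepIndexZero_ne_zeroG (hη₀c : Continuous fun p => ((η₀ p : ℂˣ) : ℂ))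
    (h₁W : (∀ j, 0 < (ι₁ (dW S j)).re) ∨ ∀ j, (ι₁ (dW S j)).re < 0) (x : Fin 3 → ↥(maximalRealSubfield L)) (N : ℕ) :
    deepIndexZeroG V S hGR hGR₀ hGR₁ η₀ hη₀c h₁W x N ≠ 0 :=
  (Classical.choose_spec (exists_deepFix_zeroG V S hGR hGR₀ hGR₁ η₀ hη₀c h₁W x N)).1

/-- **the (D-2) index of line 1**. -/
def deepIndexOneG (hη₁c : Continuous fun p => ((η₁ p : ℂˣ) : ℂ)) (x : Fin 3 → ↥(maximalRealSubfield L)) (N : ℕ) : ℕ :=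
  Classical.choose (exists_deepFix_oneG V S hGR hGR₀ hGR₁ η₁ hη₁c x N)

/-- (Ported verbatim from the HodgeCMPerL package; no docstring in the source.) -/
theorem deepIndexOne_ne_zeroG (hη₁c : Continuous fun p => ((η₁ p : ℂˣ) : ℂ)) (x : Fin 3 → ↥(maximalRealSubfield L)) (N : ℕ) :
    deepIndexOneG V S hGR hGR₀ hGR₁ η₁ hη₁c x N ≠ 0 :=
  (Classical.choose_spec (exists_deepFix_oneG V S hGR hGR₀ hGR₁ η₁ hη₁c x N)).1

/-- **`hfin` FOR LINE 0 AT THE PIN on every deep level `deepLevel V M`, `deepIndexZeroG ∣ M`.** -/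
theorem hfin_zero_deepLevelG (hη₀c : Continuous fun p => ((η₀ p : ℂˣ) : ℂ))
    (h₁W : (∀ j, 0 < (ι₁ (dW S j)).re) ∨ ∀ j, (ι₁ (dW S j)).re < 0) (x : Fin 3 → ↥(maximalRealSubfield L)) (N : ℕ)
    {M : ℕ} (hM : M ≠ 0) (hdvd : deepIndexZeroG V S hGR hGR₀ hGR₁ η₀ hη₀c h₁W x N ∣ M) :
    ∀ kf : UnitaryGroup.finAdelic (↥(maximalRealSubfield L)) L (IsCMField.complexConj L) 3 V.Hm, kf ∈ (deepLevel V M hM).K →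
      ∀ Φinf : 𝓢((Fin 3 → mixedSpace (↥(maximalRealSubfield L))), ℂ),
        lineRepOf V S hGR hGR₀ hGR₁ hGR₂ hGR₃ η₀ η₁ η₂ η₃ 0
            (HodgeCM.Adelic.regimeEquiv L V.Hm hV
              (UnitaryGroup.finAdelicToAdelic (↥(maximalRealSubfield L)) L (IsCMField.complexConj L) 3 V.Hm kf), 1)
            (testFun (↥(maximalRealSubfield L)) (Fin 3) Φinf x N) =
          testFun (↥(maximalRealSubfield L)) (Fin 3) Φinf x N := by
  intro kf hkf Φinf
  rw [lineRepOf_zero_regime_finAdelicG V S hGR hGR₀ hGR₁ hGR₂ hGR₃ η₀ η₁ η₂ η₃ hV kf]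
  exact (Classical.choose_spec (exists_deepFix_zeroG V S hGR hGR₀ hGR₁ η₀ hη₀c h₁W x N)).2 M hM hdvd _
    (finFrameCongr_mem_of_mem_deepFinLevel V hkf) Φinf

/-- **`hfin` FOR LINE 1 AT THE PIN on every deep level `deepLevel V M`, `deepIndexOneG ∣ M`.** -/
theorem hfin_one_deepLevelG (hη₁c : Continuous fun p => ((η₁ p : ℂˣ) : ℂ)) (x : Fin 3 → ↥(maximalRealSubfield L)) (N : ℕ)
    {M : ℕ} (hM : M ≠ 0) (hdvd : deepIndexOneG V S hGR hGR₀ hGR₁ η₁ hη₁c x N ∣ M) :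
    ∀ kf : UnitaryGroup.finAdelic (↥(maximalRealSubfield L)) L (IsCMField.complexConj L) 3 V.Hm, kf ∈ (deepLevel V M hM).K →
      ∀ Φinf : 𝓢((Fin 3 → mixedSpace (↥(maximalRealSubfield L))), ℂ),
        lineRepOf V S hGR hGR₀ hGR₁ hGR₂ hGR₃ η₀ η₁ η₂ η₃ 1
            (HodgeCM.Adelic.regimeEquiv L V.Hm hV
              (UnitaryGroup.finAdelicToAdelic (↥(maximalRealSubfield L)) L (IsCMField.complexConj L) 3 V.Hm kf), 1)
            (testFun (↥(maximalRealSubfield L)) (Fin 3) Φinf x N) =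
          testFun (↥(maximalRealSubfield L)) (Fin 3) Φinf x N := by
  intro kf hkf Φinf
  rw [lineRepOf_one_regime_finAdelicG V S hGR hGR₀ hGR₁ hGR₂ hGR₃ η₀ η₁ η₂ η₃ hV kf]
  exact (Classical.choose_spec (exists_deepFix_oneG V S hGR hGR₀ hGR₁ η₁ hη₁c x N)).2 M hM hdvd _
    (finFrameCongr_mem_of_mem_deepFinLevel V hkf) Φinf

end FinChar

end HodgeCM.Model

end
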